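import Summits.QuantumFields.YangMills.Theses.SqueezedSkewness
import Summits.QuantumFields.YangMills.Theorems.LangevinControlUVOSLegsFromFemtoAndGapStubCollar6
import HarnessLib

/-!
# Route `SqueezedSkewness`, glue `ElectricSeamHGlue` (stmt-QuantumFields-23397) — BY NAME, and the upstream reduction
# `FloorUnitFBL6 → FloorUnitMomentsH`

`SeamFromMoments → FloorUnitMomentsH → ElectricSeamH` (planner ym-idea-6 g11, LINE «seam on the shared boundary law»;
the kernel-checked composition `ElectricSeamH_of` of the crux workfile `Cruxes/NT/Lines/electric_seam_fbl6_birth.lean`,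
restated against the route decls so that the item closes by name), together with the line's UPSTREAM REDUCTION
`floorUnitMomentsH_of_floorUnitFBL6 : FloorUnitFBL6 → FloorUnitMomentsH` through the LANDED collar transfer
`DlrCollarTransfer.stub_collar6 : FBL6 → MomentBounds6` (second disjunct of `FloorUnitFBL6`'s calibration hypothesis),
and the corollary `electricSeamH_of_seam_of_floorUnitFBL6 : SeamFromMoments → FloorUnitFBL6 → ElectricSeamH`.

Fleet lead `ym-spine-19353-p1` g19 (lease-less helper mode on stmt-QuantumFields-19353).  HONEST FRAMING: R2a plumbing only —
`FloorUnitFBL6` (the femto boundary law at a floor-calibrated unit, Bałaban class) and `SeamFromMoments`'s content are NOT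
proved here (the latter is the landed `ThermalDescentSeamFromMoments.seamFromMoments`); no summit, rung, crux or mass gap
follows.
-/

set_option autoImplicit false

namespace Summit.QuantumFields.YangMills.Theorems.SqueezedSkewnessElectricSeamHGlue

open Summit.QuantumFields.YangMills.Theses.SqueezedSkewness

/-- **`ElectricSeamHGlue`** (item stmt-QuantumFields-23397), BY NAME: `SeamFromMoments → FloorUnitMomentsH → ElectricSeamH`
(feed the `MomentBounds6` produced by `FloorUnitMomentsH` at the slab floor into `SeamFromMoments`). [folklore] -/
theorem electricSeamHGlue_proof :
    Summit.QuantumFields.YangMills.Theses.SqueezedSkewness.ElectricSeamHGlue := by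
  intro h1 h2 G _ _ _ _ hG r a ha ha0 St Cfg cc posE P A Ael w E Cov refl B Qrp D Drp v δ₁ δ₂ hδ hsupp hfl η hη
  exact h1 G hG r a ha ha0 (h2 G hG r a ha ha0 v δ₁ δ₂ hδ hsupp hfl) v δ₁ δ₂ hδ hsupp η hη

/-- **Upstream reduction** (the point of the g11 split): `FloorUnitFBL6 → FloorUnitMomentsH`, by the landed collar transfer
`DlrCollarTransfer.stub_collar6 : FBL6 G r a → MomentBounds6 G r a` applied to the boundary law that `FloorUnitFBL6` returns
on the slab-floor disjunct (`Or.inr`) of its calibration hypothesis. [folklore] -/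
theorem floorUnitMomentsH_of_floorUnitFBL6 (h : FloorUnitFBL6) : FloorUnitMomentsH := by
  intro G _ _ _ _ hG r a ha ha0 St Cfg cc posE P A w E Cov refl B Qrp v δ₁ δ₂ hδ hsupp hfl
  letI : MeasurableSpace G := borel G
  haveI : BorelSpace G := ⟨rfl⟩
  have hF := h G hG r a ha ha0 (Or.inr ⟨v, δ₁, δ₂, hδ, hsupp, hfl⟩)
  exact Summit.QuantumFields.YangMills.Cruxes.OSLegsFromFemtoAndGap.DlrCollarTransfer.stub_collar6 G r a hF

/-- **`ElectricSeamH` from the shared boundary-law item alone** (given the seam-from-moments transfer):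
`SeamFromMoments → FloorUnitFBL6 → ElectricSeamH`. [folklore] -/
theorem electricSeamH_of_seam_of_floorUnitFBL6 (h1 : SeamFromMoments) (h : FloorUnitFBL6) : ElectricSeamH :=
  electricSeamHGlue_proof h1 (floorUnitMomentsH_of_floorUnitFBL6 h)

end Summit.QuantumFields.YangMills.Theorems.SqueezedSkewnessElectricSeamHGlue
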